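import Summits.AtomisticToContinuum.HydrodynamicLimit.Theorems.InformationPercolationEngineLocalSecondLawInitialMatchingEnergyFluct

/-!
# Stub B′|ML (`stub_initialMatchingOfStatics`) of the line `contact-asymmetry-information` for the crux `LocalSecondLaw`
(stmt-AtomisticToContinuum-13081) — part 4b: the peculiar energy of a bounded tilt at `s = 0`

For the local Gibbs law `P_N`, a cell `S` with `P_N(S) ≥ δ″`, the tilt `ν = P_N(·|S)`, a one-particle density `f` of `ν` on `[0,τ]`
(`n_S(y) = ∫ f(0,y,v) dv`) and EVERY measurable weight `0 ≤ w ≤ 1` on `𝕋³`: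

  `| ∫∫ w(y) (|v − u₀(y)|²/(2θ₀(y))) f(0,y,v) dv dy − (3/2) ∫ w n_S | ≤ δ″⁻¹ √(K/(4(N+1)))`   (`en_energy_matching`),

`K = gaussFourthMomentConst (Fin 3)` — conditioning on an event of mass `≥ δ″` cannot move the smeared peculiar energy (the same
mechanism as the position half `tv_posDensity_L1_le`: the centred statistic `A = (N+1)⁻¹ Σᵢ w(xᵢ)(qᵢ − 3/2)` has `E_{P_N} A² ≤ K/(4(N+1))`
by part 4a, domination `ν ≤ δ″⁻¹ P_N` and Cauchy–Schwarz give `E_ν|A| ≤ δ″⁻¹ √(E_{P_N}A²)`, and the duality of the one-particle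
density — extended here to unbounded non-negative test functions by exact truncation, `en_lintegral_onePt_of_nonneg` — identifies
`E_ν A` with the left side).  Also proved: integrability of `w q f(0,·)` (`q` the reduced peculiar energy), needed by the entropy
decomposition of B′.

References: H. Spohn, *Large Scale Dynamics of Interacting Particles* (1991), Part I §2.3; I. Csiszár, Ann. Probab. 3 (1975)
146–158.  Lead c16 (prover-line-stmt-AtomisticToContinuum-13081-c16-0).
-/

noncomputable section

open scoped BigOperators Topology Classical MeasureTheory ENNReal InnerProductSpace
open Filter Set MeasureTheory Function ProbabilityTheory
open Literature.MathematicalPhysics.KineticTheory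
open Literature.Analysis.FluidPDE
open Summit.AtomisticToContinuum.HydrodynamicLimit.Theorems.LocalSecondLawNegative
open Summit.AtomisticToContinuum.HydrodynamicLimit.Theorems.LocalSecondLawLedger
open Summit.AtomisticToContinuum.HydrodynamicLimit.Theorems.LocalSecondLawContact

namespace Summit.AtomisticToContinuum.HydrodynamicLimit.Theorems.LocalSecondLawInitialMatching

variable {N : ℕ}

/-! ### Duality for unbounded non-negative test functions -/

/-- **Duality at `s = 0` for non-negative (possibly unbounded) test functions** (Lebesgue form): for a one-particle density `f`
of `ν` on `[0,τ]` with `Φ₀ = id` `ν`-a.s. and measurable `G ≥ 0`, `∫⁻ ofReal((N+1)⁻¹ Σᵢ G(zᵢ)) dν = ∫⁻ ofReal(G · f(0,·))`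
(the bounded duality on the exact truncations `min G L`, which coincide with `G` pointwise for `L` large). -/
theorem en_lintegral_onePt_of_nonneg {σ τ : ℝ} (ν : Measure (Phase N)) [IsProbabilityMeasure ν] (Φ : Flow σ N)
    (f : Pt1 → ℝ) (hτ : 0 ≤ τ) (hf : IsOneParticleDensity τ ν Φ f) (h0 : ∀ᵐ z ∂ν, Φ.flow 0 z = z)
    {G : T3 × V3 → ℝ} (hGm : Measurable G) (hG0 : ∀ p, 0 ≤ G p) :
    ∫⁻ z, ENNReal.ofReal ((N + 1 : ℝ)⁻¹ * ∑ i : Fin (N + 1), G (z i)) ∂ν =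
      ∫⁻ p : T3 × V3, ENNReal.ofReal (G p * f (0, p)) := by
  have hf0 : ∀ p, 0 ≤ f (0, p) := fun p => hf.1 _
  -- truncations
  set T : ℕ → T3 × V3 → ℝ := fun L p => min (G p) L with hT
  have hTm : ∀ L, Measurable (T L) := fun L => hGm.min measurable_const
  have hT0 : ∀ L p, 0 ≤ T L p := fun L p => le_min (hG0 p) (Nat.cast_nonneg L)
  have hTb : ∀ L, ∃ C : ℝ, ∀ p, |T L p| ≤ C := fun L => ⟨L, fun p => by
    rw [abs_of_nonneg (hT0 L p)]; exact min_le_right _ _⟩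
  have hdual : ∀ L, ∫⁻ z, ENNReal.ofReal ((N + 1 : ℝ)⁻¹ * ∑ i : Fin (N + 1), T L (z i)) ∂ν =
      ∫⁻ p : T3 × V3, ENNReal.ofReal (T L p * f (0, p)) := by
    intro L
    obtain ⟨hi, he⟩ := contactB_onePt_zero ν Φ f hτ hf h0 (T L) (hTm L) (hTb L)
    have hnn1 : 0 ≤ᵐ[ν] fun z => (N + 1 : ℝ)⁻¹ * ∑ i : Fin (N + 1), T L (z i) :=
      ae_of_all _ fun z => mul_nonneg (inv_nonneg.2 (by positivity)) (Finset.sum_nonneg fun i _ => hT0 L _)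
    have hi2 : Integrable fun p : T3 × V3 => T L p * f (0, p) := by
      obtain ⟨C, hC⟩ := hTb L
      exact (tv_integrable_slice_zero ν Φ f hτ hf).bdd_mul (hTm L).aestronglyMeasurable
        (ae_of_all _ fun p => by rw [Real.norm_eq_abs]; exact hC p)
    rw [← ofReal_integral_eq_lintegral_ofReal hi hnn1, ← ofReal_integral_eq_lintegral_ofReal hi2
      (ae_of_all _ fun p => mul_nonneg (hT0 L p) (hf0 p)), he]
  -- both sides are suprema of their truncations, attained pointwise
  have hL : ∀ z : Phase N, ∃ L : ℕ, ∀ i, G (z i) ≤ L := by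
    intro z
    obtain ⟨L, hL⟩ := exists_nat_ge (∑ i : Fin (N + 1), G (z i))
    exact ⟨L, fun i => (Finset.single_le_sum (fun j _ => hG0 (z j)) (Finset.mem_univ i)).trans hL⟩
  have lhs : (fun z : Phase N => ENNReal.ofReal ((N + 1 : ℝ)⁻¹ * ∑ i : Fin (N + 1), G (z i))) =
      fun z => ⨆ L : ℕ, ENNReal.ofReal ((N + 1 : ℝ)⁻¹ * ∑ i : Fin (N + 1), T L (z i)) := by
    funext z
    refine le_antisymm ?_ (iSup_le fun L => ENNReal.ofReal_le_ofReal (mul_le_mul_of_nonneg_left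
      (Finset.sum_le_sum fun i _ => min_le_left _ _) (inv_nonneg.2 (by positivity))))
    obtain ⟨L, hLz⟩ := hL z
    refine le_iSup_of_le L (le_of_eq ?_)
    congr 2
    exact Finset.sum_congr rfl fun i _ => (min_eq_left (hLz i)).symm
  have rhs : (fun p : T3 × V3 => ENNReal.ofReal (G p * f (0, p))) =
      fun p => ⨆ L : ℕ, ENNReal.ofReal (T L p * f (0, p)) := by
    funext p
    refine le_antisymm ?_ (iSup_le fun L => ENNReal.ofReal_le_ofReal
      (mul_le_mul_of_nonneg_right (min_le_left _ _) (hf0 p)))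
    obtain ⟨L, hLp⟩ := exists_nat_ge (G p)
    refine le_iSup_of_le L (le_of_eq ?_)
    rw [hT]; dsimp only; rw [min_eq_left hLp]
  have hmono1 : Monotone fun (L : ℕ) (z : Phase N) => ENNReal.ofReal ((N + 1 : ℝ)⁻¹ * ∑ i : Fin (N + 1), T L (z i)) := by
    intro L L' hLL' z
    refine ENNReal.ofReal_le_ofReal (mul_le_mul_of_nonneg_left (Finset.sum_le_sum fun i _ => ?_)
      (inv_nonneg.2 (by positivity)))
    exact min_le_min le_rfl (by exact_mod_cast hLL')
  have hmono2 : Monotone fun (L : ℕ) (p : T3 × V3) => ENNReal.ofReal (T L p * f (0, p)) := by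
    intro L L' hLL' p
    refine ENNReal.ofReal_le_ofReal (mul_le_mul_of_nonneg_right ?_ (hf0 p))
    exact min_le_min le_rfl (by exact_mod_cast hLL')
  have hmeas1 : ∀ L, Measurable fun z : Phase N => ENNReal.ofReal ((N + 1 : ℝ)⁻¹ * ∑ i : Fin (N + 1), T L (z i)) :=
    fun L => (measurable_const.mul (Finset.measurable_sum _ fun i _ =>
      (hTm L).comp (measurable_pi_apply i))).ennreal_ofReal
  have hmeas2 : ∀ L, Measurable fun p : T3 × V3 => ENNReal.ofReal (T L p * f (0, p)) :=
    fun L => ((hTm L).mul (tv_measurable_slice_zero hf)).ennreal_ofReal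
  rw [lhs, rhs, lintegral_iSup hmeas1 hmono1, lintegral_iSup hmeas2 hmono2]
  exact iSup_congr hdual

/-! ### Velocity averaging of a one-body square under the local Gibbs measure -/

/-- **Second moment of the reduced peculiar energy under the local Gibbs measure**:
`∫⁻ ofReal((N+1)⁻¹ Σᵢ (q(xᵢ,vᵢ) − 3/2)²) dP_N ≤ ofReal(K/4)` (velocity averaging inside the disintegration). -/
theorem en_lintegral_avg_sq_le {a₀ θ₀ : T3 → ℝ} {u₀ : T3 → V3} (ha : Continuous a₀) (hθ : Continuous θ₀)
    (hu : Continuous u₀) (ha0 : ∀ x, 0 ≤ a₀ x) (hθ0 : ∀ x, 0 < θ₀ x) (σ : ℝ) (N : ℕ)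
    [IsProbabilityMeasure (localGibbsMeasure σ a₀ u₀ θ₀ N)] :
    ∫⁻ z, ENNReal.ofReal (((N + 1 : ℕ) : ℝ)⁻¹ *
        ∑ i, (‖(z i).2 - u₀ (z i).1‖ ^ 2 / (2 * θ₀ (z i).1) - 3 / 2) ^ 2) ∂(localGibbsMeasure σ a₀ u₀ θ₀ N) ≤
      ENNReal.ofReal (gaussFourthMomentConst (Fin 3) / 4) := by
  set B : ℝ := gaussFourthMomentConst (Fin 3) / 4 with hB
  have hB0 : 0 ≤ B := by rw [hB]; exact div_nonneg gaussFourthMomentConst_nonneg (by norm_num)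
  set Y : T3 → V3 → ℝ := fun y v => ‖v - u₀ y‖ ^ 2 / (2 * θ₀ y) - 3 / 2 with hY
  have hYm : Measurable fun p : T3 × V3 => Y p.1 p.2 := by
    rw [hY]
    exact (((measurable_snd.sub (hu.measurable.comp measurable_fst)).norm.pow_const 2).div
      ((hθ.measurable.comp measurable_fst).const_mul 2)).sub measurable_const
  set F : Config (N + 1) (Fin 3) T3 → ℝ := fun z => ((N + 1 : ℕ) : ℝ)⁻¹ * ∑ i, Y (z i).1 (z i).2 ^ 2 with hF
  have hFm : Measurable F :=
    measurable_const.mul (Finset.measurable_sum _ fun i _ => (hYm.comp (measurable_pi_apply i)).pow_const 2)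
  show ∫⁻ z, ENNReal.ofReal (F z) ∂(localGibbsMeasure σ a₀ u₀ θ₀ N) ≤ ENNReal.ofReal B
  rw [lintegral_localGibbsMeasure ha hθ hu ha0 hθ0 σ N hFm.ennreal_ofReal]
  have hvel : ∀ x : Fin (N + 1) → T3,
      ∫⁻ v, ENNReal.ofReal (F (zipConfig (x, v))) ∂(velMeasure u₀ θ₀ x) ≤ ENNReal.ofReal B := by
    intro x
    have hN : (0 : ℝ) < ((N + 1 : ℕ) : ℝ) := by positivity
    -- `ofReal` of the average is at most the average of `ofReal`
    have hpt : ∀ v : Fin (N + 1) → V3, ENNReal.ofReal (F (zipConfig (x, v))) =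
        ENNReal.ofReal (((N + 1 : ℕ) : ℝ)⁻¹) * ∑ i, ENNReal.ofReal (Y (x i) (v i) ^ 2) := by
      intro v
      simp only [hF, zipConfig_apply]
      rw [ENNReal.ofReal_mul (inv_nonneg.2 hN.le), ENNReal.ofReal_sum_of_nonneg fun i _ => sq_nonneg _]
    simp_rw [hpt]
    have hmi : ∀ i : Fin (N + 1), Measurable fun v : Fin (N + 1) → V3 => ENNReal.ofReal (Y (x i) (v i) ^ 2) :=
      fun i => ((hYm.comp (measurable_const.prodMk (measurable_pi_apply i))).pow_const 2).ennreal_ofReal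
    rw [lintegral_const_mul _ (Finset.measurable_sum _ fun i _ => hmi i), lintegral_finsetSum _ fun i _ => hmi i]
    -- each term is a one-coordinate integral
    have hterm : ∀ i : Fin (N + 1), ∫⁻ v, ENNReal.ofReal (Y (x i) (v i) ^ 2) ∂(velMeasure u₀ θ₀ x) ≤ ENNReal.ofReal B := by
      intro i
      unfold velMeasure
      have hmp := measurePreserving_eval (fun j : Fin (N + 1) => gaussMeasure (u₀ (x j)) (θ₀ (x j))) i
      rw [hmp.lintegral_comp (f := fun w => ENNReal.ofReal (Y (x i) w ^ 2))
        ((hYm.comp (measurable_const.prodMk measurable_id)).pow_const 2).ennreal_ofReal]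
      obtain ⟨hmem, hmean, hvar⟩ := en_peculiar_moments (hθ0 (x i)) (u₀ (x i))
      have hint : Integrable (fun w => Y (x i) w ^ 2) (gaussMeasure (u₀ (x i)) (θ₀ (x i))) := hmem.integrable_sq
      rw [← ofReal_integral_eq_lintegral_ofReal hint (ae_of_all _ fun w => sq_nonneg _)]
      refine ENNReal.ofReal_le_ofReal ?_
      have hv : Var[Y (x i); gaussMeasure (u₀ (x i)) (θ₀ (x i))] = ∫ w, Y (x i) w ^ 2 ∂(gaussMeasure (u₀ (x i)) (θ₀ (x i))) := by
        rw [variance_eq_integral hmem.aestronglyMeasurable.aemeasurable]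
        have : ∫ w, Y (x i) w ∂(gaussMeasure (u₀ (x i)) (θ₀ (x i))) = 0 := hmean
        rw [this]
        simp only [sub_zero]
        rfl
      rw [← hv]; exact hvar
    calc ENNReal.ofReal (((N + 1 : ℕ) : ℝ)⁻¹) * ∑ i, ∫⁻ v, ENNReal.ofReal (Y (x i) (v i) ^ 2) ∂(velMeasure u₀ θ₀ x)
        ≤ ENNReal.ofReal (((N + 1 : ℕ) : ℝ)⁻¹) * ∑ _i : Fin (N + 1), ENNReal.ofReal B :=
          mul_le_mul_right (Finset.sum_le_sum fun i _ => hterm i) _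
      _ = ENNReal.ofReal B := by
          rw [Finset.sum_const, Finset.card_univ, Fintype.card_fin, nsmul_eq_mul, ← mul_assoc,
            ← ENNReal.ofReal_natCast, ← ENNReal.ofReal_mul (inv_nonneg.2 hN.le), inv_mul_cancel₀ hN.ne',
            ENNReal.ofReal_one, one_mul]
  calc ∫⁻ x, ENNReal.ofReal ((canonicalPartition (Torus.geometry (Fin 3)) (hsDiameter σ N) (N + 1)
          (localGibbsProfile a₀ u₀ θ₀))⁻¹ * posWeight a₀ (hsDiameter σ N) (N + 1) x) *
          ∫⁻ v, ENNReal.ofReal (F (zipConfig (x, v))) ∂(velMeasure u₀ θ₀ x)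
      ≤ ∫⁻ x, ENNReal.ofReal ((canonicalPartition (Torus.geometry (Fin 3)) (hsDiameter σ N) (N + 1)
          (localGibbsProfile a₀ u₀ θ₀))⁻¹ * posWeight a₀ (hsDiameter σ N) (N + 1) x) * ENNReal.ofReal B :=
        lintegral_mono fun x => mul_le_mul_right (hvel x) _
    _ = ENNReal.ofReal B := by
        rw [lintegral_mul_const' _ _ ENNReal.ofReal_ne_top, lintegral_posWeight_eq_one ha hθ hu ha0 hθ0 σ N, one_mul]

/-! ### The peculiar energy of a bounded tilt -/

/-- **Peculiar-energy matching of every bounded tilt (B′, velocity half: second moments).**  For continuous profiles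
`a₀, θ₀ > 0`, `u₀`, `σ ≤ 1/2`, a cell `S` with `P_N(S) ≥ δ″ > 0`, a one-particle density `f` of `P_N(·|S)` on `[0,τ]` (`τ ≥ 0`) and
EVERY measurable weight `0 ≤ w ≤ 1`: the smeared reduced peculiar energy `w(y)·|v − u₀(y)|²/(2θ₀(y))·f(0,y,v)` is integrable on
`𝕋³ × ℝ³` and `|∫∫ w q f(0,·) − (3/2) ∫ w n_S| ≤ δ″⁻¹ √(K/4/(N+1))`, `K = gaussFourthMomentConst (Fin 3)`. -/
theorem en_energy_matching : ∀ {a₀ θ₀ : T3 → ℝ} {u₀ : T3 → V3} (ha : Continuous a₀) (hθ : Continuous θ₀) (hu : Continuous u₀) (ha0 : ∀ x, 0 < a₀ x) (hθ0 : ∀ x, 0 < θ₀ x) {σ : ℝ}, σ ≤ 1 / 2 → ∀ {N : ℕ} {τ : ℝ}, 0 ≤ τ → ∀ (Φ : Flow σ N) (S : Set (Phase N)) {δ'' : ℝ}, 0 < δ'' → ENNReal.ofReal δ'' ≤ localGibbsLaw σ a₀ u₀ θ₀ N Φ S → ∀ (f : Pt1 → ℝ), IsOneParticleDensity τ (condLaw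 (localGibbsLaw σ a₀ u₀ θ₀ N Φ) S) Φ f → ∀ (w : T3 → ℝ), Measurable w → (∀ y, 0 ≤ w y) → (∀ y, w y ≤ 1) → Integrable (fun p : T3 × V3 => w p.1 * (‖p.2 - u₀ p.1‖ ^ 2 / (2 * θ₀ p.1)) * f (0, p)) ∧ |(∫ p : T3 × V3, w p.1 * (‖p.2 - u₀ p.1‖ ^ 2 / (2 * θ₀ p.1)) * f (0, p)) - 3 / 2 * ∫ y, w y * ∫ v, f (0, y, v)| ≤ δ''⁻¹ * Real.sqrt (gaussFourthMomentConst (Fin 3) / 4 / (N + 1 : ℕ)) := by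
  intro a₀ θ₀ u₀ ha hθ hu ha0 hθ0 σ hσ N τ hτ Φ S δ'' hδ hS f hf w hwm hw0 hw1
  set μ : Measure (Phase N) := localGibbsLaw σ a₀ u₀ θ₀ N Φ with hμ
  haveI : IsProbabilityMeasure μ := isProbabilityMeasure_localGibbsLaw ha hθ hu ha0 hθ0 hσ N Φ
  haveI : IsProbabilityMeasure (localGibbsMeasure σ a₀ u₀ θ₀ N) :=
    isProbabilityMeasure_localGibbsMeasure ha hθ hu ha0 hθ0 hσ N
  set ν : Measure (Phase N) := condLaw μ S with hν
  haveI : IsProbabilityMeasure ν := contactB_condLaw_isProbability_of_floor μ S δ'' hδ hS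
  have hS0 : μ S ≠ 0 := fun h0 => by
    rw [h0] at hS
    exact absurd (nonpos_iff_eq_zero.1 hS) (by rw [ENNReal.ofReal_eq_zero]; linarith)
  have h0 : ∀ᵐ z ∂ν, Φ.flow 0 z = z := contactB_flow_zero_ae_condLaw σ a₀ θ₀ u₀ Φ S
  have hw1' : ∀ y, |w y| ≤ 1 := fun y => by rw [abs_of_nonneg (hw0 y)]; exact hw1 y
  set KB : ℝ := gaussFourthMomentConst (Fin 3) / 4 / (N + 1 : ℕ) with hKB
  have hKB0 : 0 ≤ KB := by rw [hKB]; exact div_nonneg (div_nonneg gaussFourthMomentConst_nonneg (by norm_num)) (by positivity)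
  -- the reduced peculiar energy and the statistics
  set q : T3 × V3 → ℝ := fun p => ‖p.2 - u₀ p.1‖ ^ 2 / (2 * θ₀ p.1) with hq
  have hqm : Measurable q :=
    ((measurable_snd.sub (hu.measurable.comp measurable_fst)).norm.pow_const 2).div
      ((hθ.measurable.comp measurable_fst).const_mul 2)
  have hq0 : ∀ p, 0 ≤ q p := fun p => div_nonneg (sq_nonneg _) (mul_nonneg zero_le_two (hθ0 p.1).le)
  set G : T3 × V3 → ℝ := fun p => w p.1 * q p with hG
  have hGm : Measurable G := (hwm.comp measurable_fst).mul hqm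
  have hG0 : ∀ p, 0 ≤ G p := fun p => mul_nonneg (hw0 _) (hq0 p)
  set A1 : Phase N → ℝ := fun z => (N + 1 : ℝ)⁻¹ * ∑ i : Fin (N + 1), w (z i).1 * (q (z i) - 3 / 2) with hA1
  set Aq : Phase N → ℝ := fun z => (N + 1 : ℝ)⁻¹ * ∑ i : Fin (N + 1), G (z i) with hAq
  set Aw : Phase N → ℝ := fun z => (N + 1 : ℝ)⁻¹ * ∑ i : Fin (N + 1), w (z i).1 with hAw
  have hN : (0 : ℝ) < N + 1 := by positivity
  have hA1m : Measurable A1 :=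
    measurable_const.mul (Finset.measurable_sum _ fun i _ =>
      (hwm.comp (measurable_pi_apply i).fst).mul ((hqm.comp (measurable_pi_apply i)).sub_const _))
  have hsplit : ∀ z, A1 z = Aq z - 3 / 2 * Aw z := by
    intro z
    simp only [hA1, hAq, hAw, hG, mul_sub, Finset.sum_sub_distrib, ← Finset.sum_mul]
    ring
  -- Step 1: `E_μ A1² ≤ K/4/(N+1)` from part 4a
  have hLB : ∫⁻ z, ENNReal.ofReal (A1 z ^ 2) ∂μ ≤ ENNReal.ofReal KB := by
    have h := en_lintegral_fluct_sq_le ha hθ hu (fun x => (ha0 x).le) hθ0 σ N hwm hw1'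
    rw [hμ, localGibbsLaw_eq]
    refine le_of_eq_of_le (lintegral_congr fun z => ?_) h
    congr 1
    rw [hA1]; dsimp only
    push_cast
    rfl
  have hA1sq : Integrable (fun z => A1 z ^ 2) μ := by
    refine ⟨(hA1m.pow_const 2).aestronglyMeasurable, ?_⟩
    rw [hasFiniteIntegral_iff_ofReal (ae_of_all _ fun z => sq_nonneg _)]
    exact hLB.trans_lt ENNReal.ofReal_lt_top
  have hA1L2 : MemLp A1 2 μ := (memLp_two_iff_integrable_sq hA1m.aestronglyMeasurable).2 hA1sq
  have hA1i : Integrable A1 μ := hA1L2.integrable one_le_two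
  have hE2 : ∫ z, A1 z ^ 2 ∂μ ≤ KB := by
    rw [integral_eq_lintegral_of_nonneg_ae (ae_of_all _ fun z => sq_nonneg _) (hA1m.pow_const 2).aestronglyMeasurable]
    have := ENNReal.toReal_mono ENNReal.ofReal_ne_top hLB
    rwa [ENNReal.toReal_ofReal hKB0] at this
  -- Steps 2–3: `E_ν |A1| ≤ δ″⁻¹ √KB`
  have hEabs : ∫ z, |A1 z| ∂μ ≤ Real.sqrt KB :=
    (LGFS.integral_abs_le_sqrt_of_memLp hA1L2).trans (Real.sqrt_le_sqrt hE2)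
  have hνle : ν ≤ (μ S)⁻¹ • μ := contactB_condLaw_le_smul μ S
  have hA1iν : Integrable A1 ν := hA1i.of_measure_le_smul (ENNReal.inv_ne_top.2 hS0) hνle
  have hEνabs : ∫ z, |A1 z| ∂ν ≤ δ''⁻¹ * Real.sqrt KB :=
    (tv_condLaw_integral_le_of_floor μ S hδ hS (fun z => |A1 z|) (fun z => abs_nonneg _) hA1i.abs).trans
      (mul_le_mul_of_nonneg_left hEabs (inv_nonneg.2 hδ.le))
  -- Step 4a: the bounded statistic
  obtain ⟨hAwi, hAwe⟩ := tv_onePt_pos ν Φ f hτ hf h0 hwm hw1'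
  -- Step 4b: the unbounded statistic through the Lebesgue duality
  have hdual := en_lintegral_onePt_of_nonneg ν Φ f hτ hf h0 hGm hG0
  have hAq_eq : ∀ z, Aq z = A1 z + 3 / 2 * Aw z := fun z => by rw [hsplit]; ring
  have hAqiν : Integrable Aq ν := by
    have : Integrable (fun z => A1 z + 3 / 2 * Aw z) ν := hA1iν.add (hAwi.const_mul _)
    exact this.congr (ae_of_all _ fun z => (hAq_eq z).symm)
  have hAq0 : ∀ z, 0 ≤ Aq z := fun z =>
    mul_nonneg (inv_nonneg.2 hN.le) (Finset.sum_nonneg fun i _ => hG0 _)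
  have hfin : ∫⁻ p : T3 × V3, ENNReal.ofReal (G p * f (0, p)) = ENNReal.ofReal (∫ z, Aq z ∂ν) := by
    rw [← hdual, ofReal_integral_eq_lintegral_ofReal hAqiν (ae_of_all _ hAq0)]
  have hGf0 : ∀ p, 0 ≤ G p * f (0, p) := fun p => mul_nonneg (hG0 p) (hf.1 _)
  have hGfi : Integrable fun p : T3 × V3 => G p * f (0, p) := by
    refine ⟨(hGm.mul (tv_measurable_slice_zero hf)).aestronglyMeasurable, ?_⟩
    rw [hasFiniteIntegral_iff_ofReal (ae_of_all _ hGf0), hfin]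
    exact ENNReal.ofReal_lt_top
  have hGfe : ∫ p : T3 × V3, G p * f (0, p) = ∫ z, Aq z ∂ν := by
    have h1 := ofReal_integral_eq_lintegral_ofReal hGfi (ae_of_all _ hGf0)
    rw [hfin] at h1
    exact (ENNReal.ofReal_eq_ofReal_iff (integral_nonneg hGf0) (integral_nonneg hAq0)).1 h1
  -- Step 4c: `E_ν A1 = ∫∫ w q f − (3/2) ∫ w n_S`
  have hEνA1 : ∫ z, A1 z ∂ν = (∫ p : T3 × V3, G p * f (0, p)) - 3 / 2 * ∫ y, w y * ∫ v, f (0, y, v) := by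
    rw [hGfe, ← hAwe, ← integral_const_mul, ← integral_sub hAqiν (hAwi.const_mul _)]
    exact integral_congr_ae (ae_of_all _ fun z => hsplit z)
  -- assemble
  refine ⟨?_, ?_⟩
  · refine hGfi.congr (ae_of_all _ fun p => ?_)
    show w p.1 * q p * f (0, p) = w p.1 * (‖p.2 - u₀ p.1‖ ^ 2 / (2 * θ₀ p.1)) * f (0, p)
    rfl
  · have e1 : (∫ p : T3 × V3, w p.1 * (‖p.2 - u₀ p.1‖ ^ 2 / (2 * θ₀ p.1)) * f (0, p)) = ∫ p : T3 × V3, G p * f (0, p) := rfl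
    rw [e1, ← hEνA1]
    exact (abs_integral_le_integral_abs).trans hEνabs

end Summit.AtomisticToContinuum.HydrodynamicLimit.Theorems.LocalSecondLawInitialMatching

end
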